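import Mathlib
import HarnessLib
import Summits.HubbardSuperconductivity.HubbardSuperconductivity.Theorems.KLProgrammeKLRegimeFlowReadScaleZeroMixed
import Summits.HubbardSuperconductivity.HubbardSuperconductivity.Theorems.KLProgrammeC4aTadpoleJetAssembly

/-!
# Route `KLProgramme`, crux K3 — gen-8 ENGINE-FLOW child (stmt-HubbardSuperconductivity-20437 `KLRegimeEngineV17F2`), stub (C) at `n = 0`,
# located item #22 «(C)-SCALE0-PT2», assembly kit (1/4): ON-CURVE ROWS OF A THREE-PIECE MOMENTUM-SIDE ELEMENT (generic pieces)

Seat hubbard-kl-k3c5-p1 (g14; owner of #22a).  For the MIXED door (k3c3-p1 p608958 `twoLegRead_frameZero_of_split_certD`) the momentum-side element of the split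
of record (π4, `…FlowReadScaleZeroSunsetSplit`) is `W_b″ = S + Q_c + D_e`; its interpolated symbol `H = H_S + H_Q + c_e` is read on the free Fermi curve from three
different currencies: `H_S` by momentum SIZES at orders `≤ 2` (certified sunset sums) and directly ON THE CURVE at orders `3, 4` (#22b), `H_Q` on the curve
(pure aliasing, p615543), `H_D ≡ c_e` (p619685).  **`curveRows_of_threePieces`** does this bookkeeping ONCE for three arbitrary grid elements `X, Y, Z`
(value, structured value about `τ_X + c`, jets `k ≤ 4` of `H_{X+Y+Z}∘γ₀` via additivity `evalM_symInterp_locSymbol_add`, the structured chain rule at orders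
`1, 2` (`abs_iteratedDeriv_one/two_comp_le_struct`) and `iteratedDeriv_const_add`); `bell4_mul_sq` is the `U²`-homogeneity of the Bell table.

Proofs only; no definitions; nothing asserts any stub of 20437, K3 or superconductivity.
References: BGM 2006 §2.4 (2.36), §3 (3.2)–(3.3) [cite: BenfattoGiulianiMastropietro2006].
-/

noncomputable section

namespace Summit.HubbardSuperconductivity.HubbardSuperconductivity.Theorems.KLRegimeSplit

set_option linter.dupNamespace false -- summit = problem name (single-conjunct summit), D-0017

open Real Finset Complex Literature.MathematicalPhysics.QuantumLattice Literature.Probability.LatticeModels GrassmannAlgebra Matrix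
open Literature.MathematicalPhysics.QuantumLattice.FermiRG Literature.Probability.LatticeModels.BattleFederbush
open Summit.HubbardSuperconductivity.HubbardSuperconductivity.Theorems.KLProgrammeLegKernels
open Summit.HubbardSuperconductivity.HubbardSuperconductivity.Theorems.TwoLegFourier
open Summit.HubbardSuperconductivity.HubbardSuperconductivity.Theorems.EngineV8
open Summit.HubbardSuperconductivity.HubbardSuperconductivity.Theorems.PerturbedFermiCurve
open Summit.HubbardSuperconductivity.HubbardSuperconductivity.Theorems.DispersionFlow
open Summit.HubbardSuperconductivity.HubbardSuperconductivity.Theorems.C4a (bell4)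
open scoped Nat

/-! ## §1 The Bell table is `U²`-homogeneous -/

/-- `bell4 (a·U²) D k = bell4 a D k · U²`. -/
theorem bell4_mul_sq (a D : ℕ → ℝ) (U : ℝ) (k : ℕ) : bell4 (fun j => a j * U ^ 2) D k = bell4 a D k * U ^ 2 := by
  rcases k with _ | _ | _ | _ | _ | k <;> simp [bell4] <;> ring

/-! ## §2 Curve rows of a three-piece momentum-side element -/

section Pieces

variable {L M : ℕ} [NeZero L] [NeZero M] {μ β : ℝ}

/-- **On-curve value / structured value / jets `k ≤ 4` of `H_{X+Y+Z} = H_X + H_Y + H_Z`** for three grid elements with: `H_Z ≡ c` (a constant),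
`H_Y` read on the curve (value `≤ B₀`, jets `≤ B k`), `H_X` by momentum SIZES at orders `≤ 2` (value `≤ gA`, structured value `≤ g₀` about `τX`,
sup-jets `≤ m k`) and read on the curve at orders `3, 4` (`≤ sJ k`); `H_W := evalM (symInterp L (loc (map S_{4M} W)))` (door form), `γ₀` the free
Fermi-point map with `‖γ₀^{(i)}‖ ≤ D i`. -/
theorem curveRows_of_threePieces (X Y Z : GrassmannAlgebra ℂ (GridLeg (GridPoint L (2 * (2 * M)))))
    (hγ : ContDiff ℝ 4 (fun θ : ℝ => (WithLp.toLp 2 (klFermiPoint μ 0 θ) : Momentum))) {D : ℕ → ℝ}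
    (hD : ∀ θ : ℝ, ∀ i, 1 ≤ i → i ≤ 4 → ‖iteratedDeriv i (fun θ : ℝ => (WithLp.toLp 2 (klFermiPoint μ 0 θ) : Momentum)) θ‖ ≤ D i)
    {c gA g0 τX B0 : ℝ} {m B sJ : ℕ → ℝ}
    (hZ : evalM (symInterp L (fun pp : TorusSite 2 L =>
        (∑ σσ : Fin 2, ((selfEnergy L M β (ExteriorAlgebra.map (Matrix.toLin' (gridSubMatrix L M β
            (fun p : GridPoint L (2 * (2 * M)) => p.2) (fun p => gridTime β (2 * (2 * M)) p.1))) Z) (omega0 M, pp) σσ).re +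
        (selfEnergy L M β (ExteriorAlgebra.map (Matrix.toLin' (gridSubMatrix L M β
            (fun p : GridPoint L (2 * (2 * M)) => p.2) (fun p => gridTime β (2 * (2 * M)) p.1))) Z) ((omega0 M).rev, pp) σσ).re)) / 4)) = fun _ => c)
    (hYval : ∀ θ : ℝ, |evalM (symInterp L (fun pp : TorusSite 2 L =>
        (∑ σσ : Fin 2, ((selfEnergy L M β (ExteriorAlgebra.map (Matrix.toLin' (gridSubMatrix L M β
            (fun p : GridPoint L (2 * (2 * M)) => p.2) (fun p => gridTime β (2 * (2 * M)) p.1))) Y) (omega0 M, pp) σσ).re +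
        (selfEnergy L M β (ExteriorAlgebra.map (Matrix.toLin' (gridSubMatrix L M β
            (fun p : GridPoint L (2 * (2 * M)) => p.2) (fun p => gridTime β (2 * (2 * M)) p.1))) Y) ((omega0 M).rev, pp) σσ).re)) / 4)) (WithLp.toLp 2 (klFermiPoint μ 0 θ) : Momentum)| ≤ B0)
    (hYjet : ∀ k, 1 ≤ k → k ≤ 4 → ∀ θ : ℝ, |iteratedDeriv k (fun θ : ℝ => evalM (symInterp L (fun pp : TorusSite 2 L =>
        (∑ σσ : Fin 2, ((selfEnergy L M β (ExteriorAlgebra.map (Matrix.toLin' (gridSubMatrix L M β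
            (fun p : GridPoint L (2 * (2 * M)) => p.2) (fun p => gridTime β (2 * (2 * M)) p.1))) Y) (omega0 M, pp) σσ).re +
        (selfEnergy L M β (ExteriorAlgebra.map (Matrix.toLin' (gridSubMatrix L M β
            (fun p : GridPoint L (2 * (2 * M)) => p.2) (fun p => gridTime β (2 * (2 * M)) p.1))) Y) ((omega0 M).rev, pp) σσ).re)) / 4)) (WithLp.toLp 2 (klFermiPoint μ 0 θ) : Momentum)) θ| ≤ B k)
    (hXval : ∀ q : Momentum, |evalM (symInterp L (fun pp : TorusSite 2 L =>
        (∑ σσ : Fin 2, ((selfEnergy L M β (ExteriorAlgebra.map (Matrix.toLin' (gridSubMatrix L M β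
            (fun p : GridPoint L (2 * (2 * M)) => p.2) (fun p => gridTime β (2 * (2 * M)) p.1))) X) (omega0 M, pp) σσ).re +
        (selfEnergy L M β (ExteriorAlgebra.map (Matrix.toLin' (gridSubMatrix L M β
            (fun p : GridPoint L (2 * (2 * M)) => p.2) (fun p => gridTime β (2 * (2 * M)) p.1))) X) ((omega0 M).rev, pp) σσ).re)) / 4)) q| ≤ gA)
    (hXτ : ∀ q : Momentum, |evalM (symInterp L (fun pp : TorusSite 2 L =>
        (∑ σσ : Fin 2, ((selfEnergy L M β (ExteriorAlgebra.map (Matrix.toLin' (gridSubMatrix L M β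
            (fun p : GridPoint L (2 * (2 * M)) => p.2) (fun p => gridTime β (2 * (2 * M)) p.1))) X) (omega0 M, pp) σσ).re +
        (selfEnergy L M β (ExteriorAlgebra.map (Matrix.toLin' (gridSubMatrix L M β
            (fun p : GridPoint L (2 * (2 * M)) => p.2) (fun p => gridTime β (2 * (2 * M)) p.1))) X) ((omega0 M).rev, pp) σσ).re)) / 4)) q - τX| ≤ g0)
    (hXjet : ∀ k, 1 ≤ k → k ≤ 2 → ∀ q : Momentum, ‖iteratedFDeriv ℝ k (evalM (symInterp L (fun pp : TorusSite 2 L =>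
        (∑ σσ : Fin 2, ((selfEnergy L M β (ExteriorAlgebra.map (Matrix.toLin' (gridSubMatrix L M β
            (fun p : GridPoint L (2 * (2 * M)) => p.2) (fun p => gridTime β (2 * (2 * M)) p.1))) X) (omega0 M, pp) σσ).re +
        (selfEnergy L M β (ExteriorAlgebra.map (Matrix.toLin' (gridSubMatrix L M β
            (fun p : GridPoint L (2 * (2 * M)) => p.2) (fun p => gridTime β (2 * (2 * M)) p.1))) X) ((omega0 M).rev, pp) σσ).re)) / 4))) q‖ ≤ m k)
    (hX34 : ∀ k, 3 ≤ k → k ≤ 4 → ∀ θ : ℝ, |iteratedDeriv k (fun θ : ℝ => evalM (symInterp L (fun pp : TorusSite 2 L =>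
        (∑ σσ : Fin 2, ((selfEnergy L M β (ExteriorAlgebra.map (Matrix.toLin' (gridSubMatrix L M β
            (fun p : GridPoint L (2 * (2 * M)) => p.2) (fun p => gridTime β (2 * (2 * M)) p.1))) X) (omega0 M, pp) σσ).re +
        (selfEnergy L M β (ExteriorAlgebra.map (Matrix.toLin' (gridSubMatrix L M β
            (fun p : GridPoint L (2 * (2 * M)) => p.2) (fun p => gridTime β (2 * (2 * M)) p.1))) X) ((omega0 M).rev, pp) σσ).re)) / 4)) (WithLp.toLp 2 (klFermiPoint μ 0 θ) : Momentum)) θ| ≤ sJ k) :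
    (∀ θ : ℝ, |evalM (symInterp L (fun pp : TorusSite 2 L =>
        (∑ σσ : Fin 2, ((selfEnergy L M β (ExteriorAlgebra.map (Matrix.toLin' (gridSubMatrix L M β
            (fun p : GridPoint L (2 * (2 * M)) => p.2) (fun p => gridTime β (2 * (2 * M)) p.1))) (X + Y + Z)) (omega0 M, pp) σσ).re +
        (selfEnergy L M β (ExteriorAlgebra.map (Matrix.toLin' (gridSubMatrix L M β
            (fun p : GridPoint L (2 * (2 * M)) => p.2) (fun p => gridTime β (2 * (2 * M)) p.1))) (X + Y + Z)) ((omega0 M).rev, pp) σσ).re)) / 4)) (WithLp.toLp 2 (klFermiPoint μ 0 θ) : Momentum)| ≤ gA + B0 + |c|) ∧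
    (∀ θ : ℝ, |evalM (symInterp L (fun pp : TorusSite 2 L =>
        (∑ σσ : Fin 2, ((selfEnergy L M β (ExteriorAlgebra.map (Matrix.toLin' (gridSubMatrix L M β
            (fun p : GridPoint L (2 * (2 * M)) => p.2) (fun p => gridTime β (2 * (2 * M)) p.1))) (X + Y + Z)) (omega0 M, pp) σσ).re +
        (selfEnergy L M β (ExteriorAlgebra.map (Matrix.toLin' (gridSubMatrix L M β
            (fun p : GridPoint L (2 * (2 * M)) => p.2) (fun p => gridTime β (2 * (2 * M)) p.1))) (X + Y + Z)) ((omega0 M).rev, pp) σσ).re)) / 4)) (WithLp.toLp 2 (klFermiPoint μ 0 θ) : Momentum) - (τX + c)| ≤ g0 + B0) ∧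
    (∀ k, 1 ≤ k → k ≤ 4 → ∀ θ : ℝ, |iteratedDeriv k (fun θ : ℝ => evalM (symInterp L (fun pp : TorusSite 2 L =>
        (∑ σσ : Fin 2, ((selfEnergy L M β (ExteriorAlgebra.map (Matrix.toLin' (gridSubMatrix L M β
            (fun p : GridPoint L (2 * (2 * M)) => p.2) (fun p => gridTime β (2 * (2 * M)) p.1))) (X + Y + Z)) (omega0 M, pp) σσ).re +
        (selfEnergy L M β (ExteriorAlgebra.map (Matrix.toLin' (gridSubMatrix L M β
            (fun p : GridPoint L (2 * (2 * M)) => p.2) (fun p => gridTime β (2 * (2 * M)) p.1))) (X + Y + Z)) ((omega0 M).rev, pp) σσ).re)) / 4)) (WithLp.toLp 2 (klFermiPoint μ 0 θ) : Momentum)) θ| ≤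
      (if k = 1 then m 1 * D 1 + B 1 else if k = 2 then m 2 * D 1 ^ 2 + m 1 * D 2 + B 2 else if k = 3 then sJ 3 + B 3 else sJ 4 + B 4)) := by
  set γ : ℝ → Momentum := (fun θ : ℝ => (WithLp.toLp 2 (klFermiPoint μ 0 θ) : Momentum)) with hγdef
  set HX : Momentum → ℝ := evalM (symInterp L (fun pp : TorusSite 2 L =>
        (∑ σσ : Fin 2, ((selfEnergy L M β (ExteriorAlgebra.map (Matrix.toLin' (gridSubMatrix L M β
            (fun p : GridPoint L (2 * (2 * M)) => p.2) (fun p => gridTime β (2 * (2 * M)) p.1))) X) (omega0 M, pp) σσ).re +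
        (selfEnergy L M β (ExteriorAlgebra.map (Matrix.toLin' (gridSubMatrix L M β
            (fun p : GridPoint L (2 * (2 * M)) => p.2) (fun p => gridTime β (2 * (2 * M)) p.1))) X) ((omega0 M).rev, pp) σσ).re)) / 4)) with hHX
  set HY : Momentum → ℝ := evalM (symInterp L (fun pp : TorusSite 2 L =>
        (∑ σσ : Fin 2, ((selfEnergy L M β (ExteriorAlgebra.map (Matrix.toLin' (gridSubMatrix L M β
            (fun p : GridPoint L (2 * (2 * M)) => p.2) (fun p => gridTime β (2 * (2 * M)) p.1))) Y) (omega0 M, pp) σσ).re +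
        (selfEnergy L M β (ExteriorAlgebra.map (Matrix.toLin' (gridSubMatrix L M β
            (fun p : GridPoint L (2 * (2 * M)) => p.2) (fun p => gridTime β (2 * (2 * M)) p.1))) Y) ((omega0 M).rev, pp) σσ).re)) / 4)) with hHY
  set HZ : Momentum → ℝ := evalM (symInterp L (fun pp : TorusSite 2 L =>
        (∑ σσ : Fin 2, ((selfEnergy L M β (ExteriorAlgebra.map (Matrix.toLin' (gridSubMatrix L M β
            (fun p : GridPoint L (2 * (2 * M)) => p.2) (fun p => gridTime β (2 * (2 * M)) p.1))) Z) (omega0 M, pp) σσ).re +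
        (selfEnergy L M β (ExteriorAlgebra.map (Matrix.toLin' (gridSubMatrix L M β
            (fun p : GridPoint L (2 * (2 * M)) => p.2) (fun p => gridTime β (2 * (2 * M)) p.1))) Z) ((omega0 M).rev, pp) σσ).re)) / 4)) with hHZ
  have hmap : ExteriorAlgebra.map (Matrix.toLin' (gridSubMatrix L M β
            (fun p : GridPoint L (2 * (2 * M)) => p.2) (fun p => gridTime β (2 * (2 * M)) p.1))) (X + Y + Z) =
      ExteriorAlgebra.map (Matrix.toLin' (gridSubMatrix L M β
            (fun p : GridPoint L (2 * (2 * M)) => p.2) (fun p => gridTime β (2 * (2 * M)) p.1))) X + ExteriorAlgebra.map (Matrix.toLin' (gridSubMatrix L M β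
            (fun p : GridPoint L (2 * (2 * M)) => p.2) (fun p => gridTime β (2 * (2 * M)) p.1))) Y + ExteriorAlgebra.map (Matrix.toLin' (gridSubMatrix L M β
            (fun p : GridPoint L (2 * (2 * M)) => p.2) (fun p => gridTime β (2 * (2 * M)) p.1))) Z := by
    rw [map_add, map_add]
  have hsum : evalM (symInterp L (fun pp : TorusSite 2 L =>
        (∑ σσ : Fin 2, ((selfEnergy L M β (ExteriorAlgebra.map (Matrix.toLin' (gridSubMatrix L M β
            (fun p : GridPoint L (2 * (2 * M)) => p.2) (fun p => gridTime β (2 * (2 * M)) p.1))) (X + Y + Z)) (omega0 M, pp) σσ).re +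
        (selfEnergy L M β (ExteriorAlgebra.map (Matrix.toLin' (gridSubMatrix L M β
            (fun p : GridPoint L (2 * (2 * M)) => p.2) (fun p => gridTime β (2 * (2 * M)) p.1))) (X + Y + Z)) ((omega0 M).rev, pp) σσ).re)) / 4)) = HX + HY + HZ := by
    rw [hmap, evalM_symInterp_locSymbol_add, evalM_symInterp_locSymbol_add]
  have hXc : ContDiff ℝ 4 HX := contDiff_evalM _
  have hYc : ContDiff ℝ 4 HY := contDiff_evalM _
  have hval : ∀ θ : ℝ, evalM (symInterp L (fun pp : TorusSite 2 L =>
        (∑ σσ : Fin 2, ((selfEnergy L M β (ExteriorAlgebra.map (Matrix.toLin' (gridSubMatrix L M β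
            (fun p : GridPoint L (2 * (2 * M)) => p.2) (fun p => gridTime β (2 * (2 * M)) p.1))) (X + Y + Z)) (omega0 M, pp) σσ).re +
        (selfEnergy L M β (ExteriorAlgebra.map (Matrix.toLin' (gridSubMatrix L M β
            (fun p : GridPoint L (2 * (2 * M)) => p.2) (fun p => gridTime β (2 * (2 * M)) p.1))) (X + Y + Z)) ((omega0 M).rev, pp) σσ).re)) / 4)) (γ θ) = HX (γ θ) + HY (γ θ) + c := fun θ => by
    rw [hsum, Pi.add_apply, Pi.add_apply, hZ]
  refine ⟨fun θ => ?_, fun θ => ?_, fun k hk1 hk4 θ => ?_⟩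
  · rw [hval θ]
    exact (abs_add_three _ _ _).trans (add_le_add (add_le_add (hXval _) (hYval θ)) le_rfl)
  · rw [hval θ]
    calc |HX (γ θ) + HY (γ θ) + c - (τX + c)| = |(HX (γ θ) - τX) + HY (γ θ)| := by ring_nf
      _ ≤ |HX (γ θ) - τX| + |HY (γ θ)| := abs_add_le _ _
      _ ≤ g0 + B0 := add_le_add (hXτ _) (hYval θ)
  · have hfun : (fun θ : ℝ => evalM (symInterp L (fun pp : TorusSite 2 L =>
        (∑ σσ : Fin 2, ((selfEnergy L M β (ExteriorAlgebra.map (Matrix.toLin' (gridSubMatrix L M β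
            (fun p : GridPoint L (2 * (2 * M)) => p.2) (fun p => gridTime β (2 * (2 * M)) p.1))) (X + Y + Z)) (omega0 M, pp) σσ).re +
        (selfEnergy L M β (ExteriorAlgebra.map (Matrix.toLin' (gridSubMatrix L M β
            (fun p : GridPoint L (2 * (2 * M)) => p.2) (fun p => gridTime β (2 * (2 * M)) p.1))) (X + Y + Z)) ((omega0 M).rev, pp) σσ).re)) / 4)) (γ θ)) = fun θ => c + ((HX ∘ γ) + (HY ∘ γ)) θ := by
      funext θ; rw [hval θ]; simp only [Pi.add_apply, Function.comp_apply]; ring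
    rw [hfun, iteratedDeriv_const_add (by omega) c]
    have hk' : ((k : ℕ) : WithTop ℕ∞) ≤ 4 := by exact_mod_cast hk4
    rw [iteratedDeriv_add (((hXc.comp hγ).of_le hk').contDiffAt) (((hYc.comp hγ).of_le hk').contDiffAt)]
    have hY : |iteratedDeriv k (HY ∘ γ) θ| ≤ B k := hYjet k hk1 hk4 θ
    have hD1 := hD θ 1 le_rfl (by norm_num)
    have hD2 := hD θ 2 (by norm_num) (by norm_num)
    have hM1 := hXjet 1 le_rfl (by norm_num) (γ θ)
    have hM2 := hXjet 2 (by norm_num) le_rfl (γ θ)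
    interval_cases k
    · have h1 := abs_iteratedDeriv_one_comp_le_struct hXc hγ hM1 hD1
      simp only [if_true]
      exact (abs_add_le _ _).trans (add_le_add h1 hY)
    · have h2 := abs_iteratedDeriv_two_comp_le_struct hXc hγ hM1 hM2 hD1 hD2
      simp only [show (2 : ℕ) ≠ 1 from by decide, if_false, if_true]
      exact (abs_add_le _ _).trans (add_le_add h2 hY)
    · have h3 : |iteratedDeriv 3 (HX ∘ γ) θ| ≤ sJ 3 := hX34 3 le_rfl (by norm_num) θ
      simp only [show (3 : ℕ) ≠ 1 from by decide, show (3 : ℕ) ≠ 2 from by decide, if_false, if_true]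
      exact (abs_add_le _ _).trans (add_le_add h3 hY)
    · have h4 : |iteratedDeriv 4 (HX ∘ γ) θ| ≤ sJ 4 := hX34 4 (by norm_num) le_rfl θ
      simp only [show (4 : ℕ) ≠ 1 from by decide, show (4 : ℕ) ≠ 2 from by decide, show (4 : ℕ) ≠ 3 from by decide, if_false]
      exact (abs_add_le _ _).trans (add_le_add h4 hY)

end Pieces

end Summit.HubbardSuperconductivity.HubbardSuperconductivity.Theorems.KLRegimeSplit

end
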